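import Summits.Ventures.HSemireg.WedgeHankelSiegelIdealPlaneRank

/-!
# Venture HSemireg — THE SIEGEL IDEAL (9): THE BLOCK-SUM KERNEL THEOREM — the kernel of `θ ↦ θ ∧ w_n(q)` on `HT^k = ⊕_{a+b=k} H^b(⋀^a T)` is the
# SUM of its block kernels exactly when the non-zero rows of the catalecticant `H_k(q)` are independent (e.g. every power `Θ^p/p!`)

HONEST FRAMING. Part of the Lean index of the computation cell `pub-hsemireg` (seat p10 gen 11, Sunday typer «UNIFORM-IN-n»).
Finite-dimensional EXTERIOR ALGEBRA over a field + ranks of Hankel matrices + binomial arithmetic (Vandermonde) ONLY; no variety, no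
cohomology theory, no sheaf, no Ext group, no semiregularity map; nothing here says that HC / HC_CM / HC_AV holds; no Literature fact is
declared or used.  Custodian versions as in `WedgeHankelSiegelIdeal` (1/3): FORMULA-N PART A §2.6 THEOREM H, §4.1″ (Dolbeault blocks);
the dictionary (`plane(a,b)` ↔ `H^b(⋀^a T)`) is QUOTED, never asserted.

WHY.  (7) `…PlaneRank` computed the kernel of the class on each block separately: the whole block if row `a` of `H_k(q)` vanishes, the
isotropic part `plane(a,b) ∩ SI_k` otherwise, and flagged «the blocks' images overlap» as NOT typed.  THIS FILE (continues namespace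
`Summit.Ventures.HSemireg.Wedge.HankelSiegelIdeal`; imports (7)) quantifies the overlap:
* §15 `blockKer n a b q` (the block kernel as a subspace of the exterior algebra; `finrank_blockKer_of_window_zero` = `C(n,a)C(n,b)`,
  `finrank_blockKer_of_window_ne` = `C(n,a)C(n,b) − C(n,a+b)`); planes with different `x`-counts are DISJOINT (`plane_le_span_Pof`,
  `disjoint_plane_sup`, from the monomial basis), so **`finrank_sup_eq_sum`: subspaces of distinct blocks add up directly**;
  `sup_blockKer_le_ker` (the sum of the block kernels lies in the kernel); `zeroRows n k q = #{a ≤ k : q_a = … = q_{a+n−k} = 0}`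
  (the zero rows of `H_k(q)`); **`finrank_sup_blockKer`: `dim Σ_a blockKer = dim SI_k + C(n,k)·#(zero rows)`** (`k ≤ n`; Vandermonde
  `Σ_a C(n,a)C(n,k−a) = C(2n,k)`); with THEOREM H's `dim ker = dim SI_k + C(n,k)·(k + 1 − rank H_k(q))` (the excess law):
  **`finrank_ker_wedge_w_sub_sup_blockKer`: the kernel exceeds the sum of the block kernels by EXACTLY `C(n,k)·(#(non-zero rows) − rank H_k(q))`
  dimensions** (the cross-block cancellations), and **THE BLOCK-SUM KERNEL THEOREM `ker_wedge_eq_sup_blockKer`: if `rank H_k(q) + #(zero rows)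
  = k + 1` (the non-zero rows are linearly independent) then `ker(θ ↦ θ ∧ w_n(q) ∣ ⋀^k) = Σ_a blockKer(a, k−a)`** — whole blocks where the row
  vanishes, isotropic parts elsewhere; instance: **`siegelIdeal_eq_sup_blocks`: for `2k ≤ n`, `SI_k = Σ_a (plane(a,k−a) ∩ SI_k)`** (via the class
  `E_k`: `rank_hankel1_delta`, `zeroRows_delta`), and in general **`siegelIdeal_eq_sup_blocks'`: `SI_k = Σ_a (plane(a,k−a) ∩ SI_k)` for EVERY
  `k`** — the Siegel ideal is bihomogeneous (its generators `E_t ∧ s_{ab}` lie in the block `(#x(t)+1, #y(t)+1)`, `igen_mem_plane`).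
In the quoted dictionary: for the powers of the polarisation (catalecticant = a `0/1` anti-diagonal band, non-zero rows independent) the kernel
of `⌟(Θ^p/p!)` on `HT^k` is read block by block: `H^b(⋀^a T)` entire for the rows `a` outside the band, its isotropic part for the rows inside.
NOT typed: the independence hypothesis for named non-monomial classes (it fails e.g. for two equal rows); an explicit description of the
cross-block kernel vectors; boxes; anything Ext-side.  Class side only.
-/

open Module

namespace Summit.Ventures.HSemireg.Wedge.HankelSiegelIdeal

open Summit.Ventures.HSemireg.Wedge Summit.Ventures.HSemireg.Wedge.Hankel
  Summit.Ventures.HSemireg.Wedge.HankelSiegel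

variable (K : Type*) [Field K] {n : ℕ}

/-! ## §15. `⋀^k` block by block: the kernel of `θ ↦ θ ∧ w_n(q)` is the SUM OF THE BLOCK KERNELS exactly when the non-zero rows of `H_k(q)` are independent -/

section BlockSum

/-- the block kernel, as a submodule of the exterior algebra: the kernel of `θ ↦ θ ∧ w_n(q)` on the `(a,b)`-plane. -/
noncomputable def blockKer (n a b : ℕ) (q : ℕ → K) : Submodule K (HT K (In n)) :=
  (LinearMap.ker (wedgeP K n a b q)).map (plane K n a b).subtype

/-- the block kernel lies in its plane. -/
lemma blockKer_le_plane (a b : ℕ) (q : ℕ → K) : blockKer K n a b q ≤ plane K n a b := Submodule.map_subtype_le _ _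

/-- its dimension is that of the kernel of the block map. -/
lemma finrank_blockKer (a b : ℕ) (q : ℕ → K) : finrank K (blockKer K n a b q) = finrank K (LinearMap.ker (wedgeP K n a b q)) :=
  Submodule.finrank_map_subtype_eq _ _

/-- elements of the block kernel are killed by the class. -/
lemma mul_w_eq_zero_of_mem_blockKer {a b : ℕ} {q : ℕ → K} {θ : HT K (In n)} (hθ : θ ∈ blockKer K n a b q) : θ * w K n n q = 0 := by
  obtain ⟨θ', hθ', rfl⟩ := hθ
  rw [SetLike.mem_coe, LinearMap.mem_ker, wedgeP, LinearMap.comp_apply, Submodule.subtype_apply, LinearMap.mulRight_apply] at hθ'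
  exact hθ'

/-- ZERO WINDOW: the block kernel is the whole block, dimension `C(n,a)·C(n,b)`. -/
lemma finrank_blockKer_of_window_zero {a b : ℕ} (hk : a + b ≤ n) {q : ℕ → K} (hq : ∀ s, s ≤ n - (a + b) → q (a + s) = 0) :
    finrank K (blockKer K n a b q) = n.choose a * n.choose b := by
  rw [finrank_blockKer, wedgeP_eq_zero_of_window K hk hq, LinearMap.ker_zero, finrank_top, finrank_plane]

/-- NON-ZERO WINDOW: the block kernel is the isotropic part, dimension `C(n,a)·C(n,b) − C(n,a+b)`. -/
lemma finrank_blockKer_of_window_ne {a b : ℕ} {q : ℕ → K} {s : ℕ} (hs : s ≤ n - (a + b)) (hq : q (a + s) ≠ 0) :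
    finrank K (blockKer K n a b q) + n.choose (a + b) = n.choose a * n.choose b := by
  rw [finrank_blockKer, ker_wedgeP_of_window_ne K hs hq]
  exact finrank_comap_plane_siegelIdeal K a b

/-- the planes sit inside the spans of the basis monomials with a prescribed number of `x`-letters … -/
lemma plane_le_span_Pof (a b : ℕ) :
    plane K n a b ≤ Submodule.span K ((fun t => B K (In n) t) '' {t | (Pof t).card = a}) := by
  rw [plane, Submodule.span_le]
  rintro _ ⟨⟨⟨P, hP⟩, ⟨Q, hQ⟩⟩, rfl⟩
  refine Submodule.subset_span ⟨xs P ∪ ys Q, ?_, rfl⟩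
  rw [Set.mem_setOf_eq, ← hP]
  congr 1
  ext c
  simp only [Pof, Finset.mem_filter, Finset.mem_univ, true_and, Finset.mem_union, castAdd_mem_xs, castAdd_notMem_ys, or_false]

/-- … hence **planes with different `x`-counts are disjoint** (as are all their subspaces). -/
lemma disjoint_plane_sup {a : ℕ} {F : Finset ℕ} (ha : a ∉ F) (b : ℕ) (g : ℕ → ℕ) (f : ℕ → Submodule K (HT K (In n)))
    (hf : ∀ a', f a' ≤ plane K n a' (g a')) : Disjoint (plane K n a b) (F.sup f) := by
  have h1 := plane_le_span_Pof K (n := n) a b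
  have h2 : F.sup f ≤ Submodule.span K ((fun t => B K (In n) t) '' {t | (Pof t).card ≠ a}) := by
    apply Finset.sup_le
    intro a' ha'
    refine (hf a').trans ((plane_le_span_Pof K a' (g a')).trans (Submodule.span_mono (Set.image_mono ?_)))
    intro t ht
    rw [Set.mem_setOf_eq] at ht ⊢
    rw [ht]; rintro rfl; exact ha ha'
  refine Disjoint.mono h1 h2 ((B K (In n)).linearIndependent.disjoint_span_image ?_)
  exact Set.disjoint_left.mpr fun t ht ht' => ht' ht

/-- **the block kernels (indeed any subspaces of distinct blocks) add up directly: `dim Σ_a K_a = Σ_a dim K_a`.** -/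
theorem finrank_sup_eq_sum (F : Finset ℕ) (g : ℕ → ℕ) (f : ℕ → Submodule K (HT K (In n))) (hf : ∀ a, f a ≤ plane K n a (g a)) :
    finrank K ↥(F.sup f) = ∑ a ∈ F, finrank K (f a) := by
  induction F using Finset.induction_on with
  | empty => rw [Finset.sup_empty, Finset.sum_empty, finrank_bot]
  | insert a F ha ih =>
    rw [Finset.sup_insert, Finset.sum_insert ha, ← ih, ← Submodule.finrank_sup_add_finrank_inf_eq,
      ((disjoint_plane_sup K ha (g a) g f hf).mono_left (hf a)).eq_bot, finrank_bot, add_zero]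

/-- the sum of the block kernels of degree `k` lies in the kernel on `⋀^k`. -/
theorem sup_blockKer_le_ker (k : ℕ) (q : ℕ → K) :
    (Finset.range (k + 1)).sup (fun a => blockKer K n a (k - a) q) ≤
      (LinearMap.ker (Hankel.wedge K n k (w K n n q))).map (⋀[K]^k (In n → K)).subtype := by
  apply Finset.sup_le
  intro a ha θ hθ
  have hak : a + (k - a) = k := by rw [Finset.mem_range] at ha; omega
  have hθk : θ ∈ ⋀[K]^k (In n → K) := by
    rw [← hak]; exact plane_le_exteriorPower K a (k - a) (blockKer_le_plane K a (k - a) q hθ)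
  refine ⟨⟨θ, hθk⟩, ?_, rfl⟩
  rw [SetLike.mem_coe, LinearMap.mem_ker, Hankel.wedge, LinearMap.comp_apply, Submodule.subtype_apply, LinearMap.mulRight_apply]
  exact mul_w_eq_zero_of_mem_blockKer K hθ

open Classical in
/-- the number of ZERO WINDOWS (zero rows of the catalecticant `H_k(q)`): `#{a ≤ k : q_a = … = q_{a+n−k} = 0}`. -/
noncomputable def zeroRows (n k : ℕ) (q : ℕ → K) : ℕ :=
  ((Finset.range (k + 1)).filter fun a => ∀ s, s ≤ n - k → q (a + s) = 0).card

/-- Vandermonde, range form: `Σ_{a ≤ k} C(n,a)·C(n,k−a) = C(2n,k)`. -/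
lemma sum_choose_mul_choose (k : ℕ) : ∑ a ∈ Finset.range (k + 1), n.choose a * n.choose (k - a) = (n + n).choose k := by
  rw [Nat.add_choose_eq, Finset.Nat.sum_antidiagonal_eq_sum_range_succ (fun a b => n.choose a * n.choose b)]

open Classical in
/-- **the block kernels of degree `k` add up to `dim SI_k + C(n,k)·#(zero rows)`** (`k ≤ n`). -/
theorem finrank_sup_blockKer {k : ℕ} (hk : k ≤ n) (q : ℕ → K) :
    finrank K ↥((Finset.range (k + 1)).sup fun a => blockKer K n a (k - a) q) =
      finrank K (siegelIdeal K n k) + n.choose k * zeroRows K n k q := by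
  rw [finrank_sup_eq_sum K _ (fun a => k - a) _ (fun a => blockKer_le_plane K a (k - a) q)]
  -- per block: dim K_a + C(n,k)·[row a ≠ 0] = C(n,a)·C(n,k−a)
  have hblk : ∀ a ∈ Finset.range (k + 1), finrank K (blockKer K n a (k - a) q) +
      n.choose k * (if (∀ s, s ≤ n - k → q (a + s) = 0) then 0 else 1) = n.choose a * n.choose (k - a) := by
    intro a ha
    have hak : a + (k - a) = k := by rw [Finset.mem_range] at ha; omega
    split_ifs with hz
    · rw [mul_zero, add_zero, finrank_blockKer_of_window_zero K (by omega) (by rw [hak]; exact hz)]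
    · have hz' : ∃ s, s ≤ n - k ∧ q (a + s) ≠ 0 := by
        by_contra h
        exact hz fun s hs => by by_contra h'; exact h ⟨s, hs, h'⟩
      obtain ⟨s, hs, hqs⟩ := hz'
      rw [mul_one, ← finrank_blockKer_of_window_ne K (a := a) (b := k - a) (s := s) (by rw [hak]; exact hs) hqs, hak]
  have hsum := Finset.sum_congr rfl hblk
  rw [Finset.sum_add_distrib, sum_choose_mul_choose, ← Finset.mul_sum] at hsum
  have hcard : (∑ a ∈ Finset.range (k + 1), if (∀ s, s ≤ n - k → q (a + s) = 0) then 0 else 1) + zeroRows K n k q = k + 1 := by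
    rw [zeroRows, Finset.card_filter, ← Finset.sum_add_distrib]
    have h1 : ∀ a ∈ Finset.range (k + 1),
        ((if (∀ s, s ≤ n - k → q (a + s) = 0) then 0 else 1) + (if (∀ s, s ≤ n - k → q (a + s) = 0) then 1 else 0) : ℕ) = 1 :=
      fun a _ => by split_ifs <;> rfl
    rw [Finset.sum_congr rfl h1, Finset.sum_const, Finset.card_range, smul_eq_mul, mul_one]
  have hSI := finrank_siegelIdeal K (n := n) k
  have e : n.choose k * (k + 1) = n.choose k * (∑ a ∈ Finset.range (k + 1), if (∀ s, s ≤ n - k → q (a + s) = 0) then 0 else 1) +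
      n.choose k * zeroRows K n k q := by rw [← mul_add, hcard]
  generalize n.choose k * (∑ a ∈ Finset.range (k + 1), if (∀ s, s ≤ n - k → q (a + s) = 0) then 0 else 1) = X at hsum e
  generalize n.choose k * zeroRows K n k q = Z at e ⊢
  have e2 : (k + 1) * n.choose k = n.choose k * (k + 1) := mul_comm _ _
  omega

/-- **THE BLOCK-SUM KERNEL THEOREM.** If the non-zero rows of `H_k(q)` are linearly independent — `rank H_k(q) + #(zero rows) = k + 1`
(e.g. every power `Θ^p/p!`, whose catalecticant is a `0/1` anti-diagonal band) — then **the kernel of `θ ↦ θ ∧ w_n(q)` on `⋀^k` is the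
SUM OF ITS BLOCK KERNELS: the whole block `H^b(⋀^a T)` where row `a` vanishes, its isotropic part `plane(a,b) ∩ SI_k` where it does not.** -/
theorem ker_wedge_eq_sup_blockKer {k : ℕ} (hk : k ≤ n) {q : ℕ → K} (hrank : (hankel1 K n k q).rank + zeroRows K n k q = k + 1) :
    (LinearMap.ker (Hankel.wedge K n k (w K n n q))).map (⋀[K]^k (In n → K)).subtype =
      (Finset.range (k + 1)).sup fun a => blockKer K n a (k - a) q := by
  symm
  apply Submodule.eq_of_le_of_finrank_eq (sup_blockKer_le_ker K k q)
  rw [finrank_sup_blockKer K hk, Submodule.finrank_map_subtype_eq, finrank_ker_wedge_w]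
  have hz : zeroRows K n k q = k + 1 - (hankel1 K n k q).rank := by omega
  rw [hz]

open Classical in
/-- in general (no hypothesis on `q`): **the block kernels account for `dim SI_k + C(n,k)·#(zero rows)` of the kernel; the remaining
`C(n,k)·(#(non-zero rows) − rank H_k(q))` dimensions come from cancellations BETWEEN blocks.** -/
theorem finrank_ker_wedge_w_sub_sup_blockKer {k : ℕ} (hk : k ≤ n) (q : ℕ → K) :
    finrank K (LinearMap.ker (Hankel.wedge K n k (w K n n q))) + n.choose k * (hankel1 K n k q).rank =
      finrank K ↥((Finset.range (k + 1)).sup fun a => blockKer K n a (k - a) q) + n.choose k * (k + 1 - zeroRows K n k q) := by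
  rw [finrank_sup_blockKer K hk, finrank_ker_wedge_w]
  obtain ⟨d, hd⟩ := Nat.exists_eq_add_of_le (rank_hankel1_le_succ K (n := n) k q)
  have hz : zeroRows K n k q ≤ k + 1 := by
    rw [zeroRows]; exact (Finset.card_filter_le _ _).trans (by rw [Finset.card_range])
  obtain ⟨e, he⟩ := Nat.exists_eq_add_of_le hz
  rw [show k + 1 - (hankel1 K n k q).rank = d by omega, show k + 1 - zeroRows K n k q = e by omega]
  have h1 : n.choose k * d + n.choose k * (hankel1 K n k q).rank = n.choose k * (k + 1) := by
    rw [← mul_add]; congr 1; omega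
  have h2 : n.choose k * zeroRows K n k q + n.choose k * e = n.choose k * (k + 1) := by
    rw [← mul_add]; congr 1; omega
  generalize n.choose k * d = A at h1 ⊢
  generalize n.choose k * (hankel1 K n k q).rank = B at h1 ⊢
  generalize n.choose k * zeroRows K n k q = C at h2 ⊢
  generalize n.choose k * e = D at h2 ⊢
  omega

/-- for the class `E_k` (`2k ≤ n`) no window vanishes: row `a ≤ k` of `H_k(δ_k)` has its `1` at column `k − a ≤ n − k`. -/
lemma zeroRows_delta {k : ℕ} (hk : k + k ≤ n) : zeroRows K n k (fun j => if j = k then (1 : K) else 0) = 0 := by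
  classical
  rw [zeroRows, Finset.card_eq_zero, Finset.filter_eq_empty_iff]
  intro a ha h
  rw [Finset.mem_range] at ha
  have := h (k - a) (by omega)
  rw [if_pos (by omega)] at this
  exact one_ne_zero this

/-- block kernels of a non-zero window are the isotropic parts of the blocks. -/
lemma blockKer_eq_of_window_ne {a b : ℕ} {q : ℕ → K} {s : ℕ} (hs : s ≤ n - (a + b)) (hq : q (a + s) ≠ 0) :
    blockKer K n a b q = plane K n a b ⊓ siegelIdeal K n (a + b) := by
  rw [blockKer, ker_wedgeP_of_window_ne K hs hq, Submodule.map_comap_subtype]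

/-- **BIHOMOGENEITY OF THE SIEGEL IDEAL (instance `q = δ_k`, `2k ≤ n`): `SI_k = Σ_a (plane(a, k−a) ∩ SI_k)`** — the Siegel ideal is the sum of
the isotropic parts of the blocks. -/
theorem siegelIdeal_eq_sup_blocks {k : ℕ} (hk : k + k ≤ n) :
    siegelIdeal K n k = (Finset.range (k + 1)).sup fun a => plane K n a (k - a) ⊓ siegelIdeal K n k := by
  have hrank : (hankel1 K n k (fun j => if j = k then (1 : K) else 0)).rank + zeroRows K n k (fun j => if j = k then (1 : K) else 0) = k + 1 := by
    rw [rank_hankel1_delta K hk, zeroRows_delta K hk, add_zero]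
  have h := ker_wedge_eq_sup_blockKer K (by omega) hrank
  rw [ker_wedge_delta_eq_siegelIdeal K hk, Submodule.map_comap_subtype, inf_eq_right.mpr (siegelIdeal_le_exteriorPower K k)] at h
  conv_lhs => rw [h]
  apply Finset.sup_congr rfl
  intro a ha
  have hak : a + (k - a) = k := by rw [Finset.mem_range] at ha; omega
  have hw : (fun j => if j = k then (1 : K) else 0) (a + (k - a)) ≠ 0 := by
    show (if a + (k - a) = k then (1 : K) else 0) ≠ 0
    rw [if_pos hak]; exact one_ne_zero
  rw [blockKer_eq_of_window_ne K (s := k - a) (by rw [hak]; omega) hw, hak]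

/-- each generator `E_t ∧ s_{ab}` of the Siegel ideal is bihomogeneous: it lies in the block `(#x(t) + 1, #y(t) + 1)`. -/
lemma igen_mem_plane {k : ℕ} (p : IIdx n k) : igen K p ∈ plane K n ((Pof p.1.1).card + 1) ((Qof p.1.1).card + 1) := by
  obtain ⟨⟨t, ht⟩, ⟨c', a'⟩⟩ := p
  have hBt : B K (In n) t ∈ plane K n (Pof t).card (Qof t).card := by
    have e : pmon K ((⟨Pof t, rfl⟩, ⟨Qof t, rfl⟩) : PIdx n (Pof t).card (Qof t).card) = B K (In n) t := by
      rw [pmon]; exact congrArg _ (xs_union_ys t)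
    rw [← e]; exact Submodule.subset_span ⟨_, rfl⟩
  have ha' : (a' : ℕ) < n := by have := a'.2; have := c'.2; omega
  have key : ∀ (d e : ℕ) (hd : d < n) (he : e < n), B K (In n) t * (X K n d * Y K n e) ∈ plane K n ((Pof t).card + 1) ((Qof t).card + 1) := by
    intro d e hd he
    rw [← mul_assoc, show X K n d = X K n ((⟨d, hd⟩ : Fin n) : ℕ) from rfl, show Y K n e = Y K n ((⟨e, he⟩ : Fin n) : ℕ) from rfl]
    exact mul_Y_mem_plane K (mul_X_mem_plane K hBt ⟨d, hd⟩) ⟨e, he⟩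
  simp only [igen, sgen, sv]
  split_ifs with h
  · rw [add_zero]; exact key _ _ ha' c'.2
  · rw [mul_add]; exact Submodule.add_mem _ (key _ _ ha' c'.2) (key _ _ c'.2 ha')

/-- the letter count of a support: `#x(t) + #y(t) = |t|`. -/
lemma card_Pof_add_card_Qof (t : Finset (In n)) : (Pof t).card + (Qof t).card = t.card := by
  conv_rhs => rw [← xs_union_ys t]
  rw [Finset.card_union_of_disjoint (disjoint_xs_ys _ _), card_xs, card_ys]

/-- **THE SIEGEL IDEAL IS BIHOMOGENEOUS: `SI_k = Σ_a (plane(a, k−a) ∩ SI_k)`** — every field, `n`, `k` (its generators are bihomogeneous). -/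
theorem siegelIdeal_eq_sup_blocks' (k : ℕ) :
    siegelIdeal K n k = (Finset.range (k + 1)).sup fun a => plane K n a (k - a) ⊓ siegelIdeal K n k := by
  apply le_antisymm
  · rw [siegelIdeal, Submodule.span_le]
    rintro _ ⟨p, rfl⟩
    have hsum : (Pof p.1.1).card + 1 + ((Qof p.1.1).card + 1) = k := by
      have := card_Pof_add_card_Qof p.1.1; have := p.1.2; omega
    have hmem : igen K p ∈ plane K n ((Pof p.1.1).card + 1) (k - ((Pof p.1.1).card + 1)) ⊓ siegelIdeal K n k := by
      refine ⟨?_, Submodule.subset_span ⟨p, rfl⟩⟩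
      have e : k - ((Pof p.1.1).card + 1) = (Qof p.1.1).card + 1 := by omega
      rw [e]; exact igen_mem_plane K p
    exact (Finset.le_sup (f := fun a => plane K n a (k - a) ⊓ siegelIdeal K n k) (Finset.mem_range.mpr (by omega))) hmem
  · exact Finset.sup_le fun a _ => inf_le_right

end BlockSum


end Summit.Ventures.HSemireg.Wedge.HankelSiegelIdeal
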